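import Literature.NumberTheory.EllipticCurves.ModularCurve
import Mathlib.Data.ZMod.Units
import Mathlib.Data.Nat.Factorization.Induction
import Mathlib.Data.Nat.Totient
import HarnessLib

/-!
# The index of `Γ₀(N)` in `SL₂(ℤ)` (trunk EllArithM, item C17; discharge of a named fact)

This file proves, sorry-free and unconditionally, the named fact
`Literature.ModularForms.index_gamma0_eq_gamma0Index N` of
`Literature.NumberTheory.EllipticCurves.ModularCurve` for every `N ≥ 1`:

  `[SL₂(ℤ) : Γ₀(N)] = ∏_{p^e ∥ N} p^{e−1}(p + 1) = N ∏_{p ∣ N} (1 + 1/p)`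

(Shimura Prop. 1.43; Diamond–Shurman Ex. 1.2.3(e)), as `index_gamma0_eq_gamma0Index_holds`.
It is item 4 of the DAG below the dimension formula `dim S₂(Γ₀(N)) = g(X₀(N))`
(`finrank_cuspForm_two_eq_genusX0`, Diamond–Shurman Thm. 3.5.1), see
`Literature.NumberTheory.EllipticCurves.ModularCurveProofs`.

## Proof

* `specialLinearGroup_map_surjective`: reduction `SL₂(ℤ) → SL₂(ℤ/Nℤ)` is onto (Shimura
  Lemma 1.38; Diamond–Shurman Ex. 1.2.2): the bottom row `(c̄, d̄)` of `Ā ∈ SL₂(ℤ/Nℤ)` lifts to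
  coprime integers (`exists_add_mul_coprime`: `d + tN` is prime to `c` for `t` the product of the
  primes dividing `c` but not `d` — the argument of Mathlib's `ZMod.unitsMap_surjective`), which
  complete to `γ₀ ∈ SL₂(ℤ)`, and `Ā γ̄₀⁻¹ = (1 b̄; 0 1)` lifts trivially.
* `index_gamma1_eq_card`: `Γ₁(N)` is the preimage of the stabiliser of `e₁ = (1, 0)ᵀ` for
  `SL₂(ℤ/Nℤ)` acting on `(ℤ/Nℤ)²`, whose orbit is the set of unimodular columns
  (`orbit_specialLinearGroup_single`), so `[SL₂(ℤ) : Γ₁(N)] = #{(a, c) ∈ (ℤ/Nℤ)² unimodular}`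
  by orbit–stabiliser.
* `card_unimodular`: that number is `∏_{p^k ∥ N} p^{k−1}(p + 1) · p^{k−1}(p − 1)`: it is
  multiplicative in `N` (Chinese remainder theorem, `card_unimodular_mul`) and modulo `p^k` a pair
  is unimodular iff one entry is a unit (`isCoprime_iff_isUnit_or`), giving
  `p^{2k} − p^{2(k−1)}` (`card_unimodular_prime_pow`).
* `relIndex_gamma1_gamma0`: `[Γ₀(N) : Γ₁(N)] = φ(N)`, `Γ₁(N)` being the kernel of the surjection
  `Γ₀(N) → (ℤ/Nℤ)ˣ`, `γ ↦ d mod N` (Mathlib `Gamma0Map`; Diamond–Shurman Ex. 1.2.3(d)).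
* `index_gamma0_eq_gamma0Index_holds`: divide `[SL₂(ℤ) : Γ₁(N)]` by Euler's product
  `φ(N) = ∏ p^{k−1}(p − 1)` (Mathlib `Nat.totient_eq_prod_factorization`).

Only theorems are added (no definitions, no new facts); everything is in
`namespace Literature.ModularForms` like `ModularCurve.lean`.

## References

* G. Shimura, *Introduction to the arithmetic theory of automorphic functions*, Princeton (1971),
  §1.6: Lemma 1.38 (surjectivity of reduction), Prop. 1.43 (index and cusps of `Γ₀(N)`), p. 42.
* F. Diamond, J. Shurman, *A first course in modular forms*, GTM 228, Springer (2005), §1.2,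
  Exercises 1.2.2 (surjectivity), 1.2.3 (orders and indices).
-/

noncomputable section

open scoped MatrixGroups

open CongruenceSubgroup Matrix Matrix.SpecialLinearGroup

namespace Literature.NumberTheory.EllipticCurves.ModularForms

/-! ### Reduction `SL₂(ℤ) → SL₂(ℤ/Nℤ)` is surjective -/

section Reduction

/-- If no prime divides all of `a`, `c` and `N ≠ 0`, then `a + t c` is prime to `N` for some `t`
(take `t` the product of the primes dividing `N` but not `a`). The case `c = n ∣ N` is the lifting
of units along `ℤ/Nℤ → ℤ/nℤ` (Mathlib `ZMod.unitsMap_surjective`, same proof). [folklore] -/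
theorem exists_add_mul_coprime {a c N : ℕ} (hN : N ≠ 0)
    (h : ∀ p, p.Prime → p ∣ a → p ∣ c → ¬p ∣ N) : ∃ t : ℕ, (a + t * c).Coprime N := by
  let ps : Finset ℕ := {p ∈ N.primeFactors | ¬p ∣ a}
  refine ⟨ps.prod id, Nat.coprime_of_dvd fun p pp hp hpN ↦ ?_⟩
  by_cases hpa : p ∣ a
  · have h1 : p ∣ ps.prod id * c := by
      have := Nat.dvd_sub hp hpa
      rwa [Nat.add_sub_cancel_left] at this
    rcases pp.dvd_mul.mp h1 with h2 | h2
    · obtain ⟨q, hq, hq'⟩ := (pp.prime.dvd_finsetProd_iff id).mp h2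
      rw [Finset.mem_filter, Nat.mem_primeFactors,
        ← (Nat.prime_dvd_prime_iff_eq pp hq.1.1).mp hq'] at hq
      exact hq.2 hpa
    · exact h p pp hpa h2 hpN
  · have pps : p ∈ ps := Finset.mem_filter.mpr ⟨Nat.mem_primeFactors.mpr ⟨pp, hpN, hN⟩, hpa⟩
    have h1 := Nat.dvd_sub hp ((Finset.dvd_prod_of_mem id pps).mul_right c)
    rw [Nat.add_sub_cancel] at h1
    exact hpa h1

variable (N : ℕ)

/-- Reduction modulo `N` on `SL₂(ℤ)` (Mathlib's `SLMOD(N)`, a local notation there). -/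
local notation "SLMOD(" N ")" =>
  @Matrix.SpecialLinearGroup.map (Fin 2) _ _ _ _ _ _ (Int.castRingHom (ZMod N))

/-- An element of `SL₂(ℤ/Nℤ)` whose bottom row is `(0, 1)` is the reduction of `(1 b; 0 1)`.
[folklore] -/
theorem exists_eq_reduce_of_apply_one_eq [NeZero N] (B : SL(2, ZMod N)) (h₀ : B 1 0 = 0)
    (h₁ : B 1 1 = 1) : ∃ γ : SL(2, ℤ), SLMOD(N) γ = B := by
  have h00 : B 0 0 = 1 := by
    have := B.det_coe
    rw [Matrix.det_fin_two] at this
    simpa [h₀, h₁] using this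
  refine ⟨⟨!![1, ((B 0 1).val : ℤ); 0, 1], by simp [Matrix.det_fin_two_of]⟩, ?_⟩
  ext i j
  fin_cases i <;> fin_cases j <;> simp [h00, h₀, h₁]

/-- **Reduction `SL₂(ℤ) → SL₂(ℤ/Nℤ)` is surjective** for `N ≥ 1` (Shimura Lemma 1.38;
Diamond–Shurman Ex. 1.2.2): lift the bottom row `(c̄, d̄)` to coprime integers `(c, d)`
(`exists_add_mul_coprime`), complete to `γ₀ ∈ SL₂(ℤ)`; then `Ā γ̄₀⁻¹` has bottom row `(0, 1)`.
[cite: ShimuraIATAF1971, Lemma 1.38] -/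
theorem specialLinearGroup_map_surjective [NeZero N] : Function.Surjective (SLMOD(N)) := by
  intro A
  -- lifts of the bottom row, with `c ≠ 0`
  set c : ℕ := (A 1 0).val + N with hc
  set d : ℕ := (A 1 1).val with hd
  have hc0 : c ≠ 0 := by
    have := NeZero.ne N
    omega
  have hcA : (c : ZMod N) = A 1 0 := by simp [hc]
  have hdA : (d : ZMod N) = A 1 1 := by simp [hd]
  -- no prime divides `d`, `N` and `c`
  have hprim : ∀ p, p.Prime → p ∣ d → p ∣ N → ¬p ∣ c := by
    intro p pp hpd hpN hpc
    haveI : Fact p.Prime := ⟨pp⟩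
    have hdet := A.det_coe
    rw [Matrix.det_fin_two] at hdet
    apply_fun ZMod.castHom hpN (ZMod p) at hdet
    rw [map_sub, map_mul, map_mul, map_one, ← hcA, ← hdA, map_natCast, map_natCast,
      (ZMod.natCast_eq_zero_iff d p).mpr hpd, (ZMod.natCast_eq_zero_iff c p).mpr hpc] at hdet
    simp at hdet
  obtain ⟨t, ht⟩ := exists_add_mul_coprime hc0 hprim
  -- Bezout: `x (d + tN) + y c = 1`
  obtain ⟨x, y, hxy⟩ := (Nat.isCoprime_iff_coprime.mpr ht : IsCoprime ((d + t * N : ℕ) : ℤ) c)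
  let γ₀ : SL(2, ℤ) := ⟨!![x, -y; (c : ℤ), ((d + t * N : ℕ) : ℤ)], by
    rw [Matrix.det_fin_two_of]; linear_combination hxy⟩
  have h10 : SLMOD(N) γ₀ 1 0 = A 1 0 := by simp [γ₀, hcA]
  have h11 : SLMOD(N) γ₀ 1 1 = A 1 1 := by simp [γ₀, hdA]
  -- `B = A γ̄₀⁻¹` has bottom row `(0, 1)`
  set B := A * (SLMOD(N) γ₀)⁻¹ with hB
  have hB10 : B 1 0 = 0 := by
    rw [hB, SL2_inv_expl, coe_mul]
    simp only [Fin.isValue, mul_apply, Fin.sum_univ_two, cons_val', cons_val_zero,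
      cons_val_one, empty_val', cons_val_fin_one]
    rw [h10, h11]
    change A 1 0 * A 1 1 + A 1 1 * -A 1 0 = 0
    ring
  have hB11 : B 1 1 = 1 := by
    rw [hB, SL2_inv_expl, coe_mul]
    simp only [Fin.isValue, mul_apply, Fin.sum_univ_two, cons_val', cons_val_zero,
      cons_val_one, empty_val', cons_val_fin_one]
    have hxy' := congrArg (Int.cast : ℤ → ZMod N) hxy
    push_cast [ZMod.natCast_self, mul_zero, add_zero] at hxy'
    change A 1 0 * -(SLMOD(N) γ₀ 0 1) + A 1 1 * SLMOD(N) γ₀ 0 0 = 1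
    rw [← hcA, ← hdA]
    simp only [γ₀, SL_reduction_mod_hom_val, of_apply, cons_val', cons_val_zero, cons_val_one,
      empty_val', cons_val_fin_one, Int.cast_neg]
    linear_combination hxy'
  obtain ⟨γ₁, hγ₁⟩ := exists_eq_reduce_of_apply_one_eq N B hB10 hB11
  refine ⟨γ₁ * γ₀, ?_⟩
  rw [map_mul, hγ₁, hB, inv_mul_cancel_right]

end Reduction

/-! ### `[SL₂(ℤ) : Γ₁(N)]` counts unimodular pairs modulo `N` -/

section Gamma1

/-- Reduction modulo `N` on `SL₂(ℤ)` (Mathlib's `SLMOD(N)`, a local notation there). -/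
local notation "SLMOD(" N ")" =>
  @Matrix.SpecialLinearGroup.map (Fin 2) _ _ _ _ _ _ (Int.castRingHom (ZMod N))

/-- The orbit of `e₁ = (1, 0)ᵀ` under `SL₂(R)` acting on `R²` is the set of **unimodular** columns
`(a, c)ᵀ`, `Ra + Rc = R` (first columns of matrices in `SL₂(R)`). [folklore] -/
theorem orbit_specialLinearGroup_single {R : Type*} [CommRing R] :
    MulAction.orbit SL(2, R) (Pi.single 0 1 : Fin 2 → R) = {v | IsCoprime (v 0) (v 1)} := by
  ext v
  simp only [MulAction.mem_orbit_iff, Set.mem_setOf_eq, Matrix.SpecialLinearGroup.smul_def,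
    Matrix.smul_eq_mulVec, Matrix.mulVec_single_one]
  constructor
  · rintro ⟨γ, rfl⟩
    have hdet := γ.det_coe
    rw [Matrix.det_fin_two] at hdet
    exact ⟨γ 1 1, -γ 0 1, by simp only [col_apply]; linear_combination hdet⟩
  · rintro ⟨x, y, h⟩
    refine ⟨⟨!![v 0, -y; v 1, x], by rw [Matrix.det_fin_two_of]; linear_combination h⟩, ?_⟩
    ext i
    fin_cases i <;> simp

variable (N : ℕ)

/-- `Γ₁(N)` is the preimage under reduction of the stabiliser of `e₁ = (1, 0)ᵀ ∈ (ℤ/Nℤ)²` in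
`SL₂(ℤ/Nℤ)` (a matrix fixing `e₁` modulo `N` has `a ≡ 1`, `c ≡ 0`, hence `d ≡ 1`). [folklore] -/
theorem gamma1_eq_comap_stabilizer :
    Gamma1 N = (MulAction.stabilizer SL(2, ZMod N) (Pi.single 0 1 : Fin 2 → ZMod N)).comap
      (SLMOD(N)) := by
  ext γ
  rw [Gamma1_mem, Subgroup.mem_comap, MulAction.mem_stabilizer_iff,
    Matrix.SpecialLinearGroup.smul_def, Matrix.smul_eq_mulVec, Matrix.mulVec_single_one]
  constructor
  · rintro ⟨h00, -, h10⟩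
    ext i
    fin_cases i <;> simp [h00, h10]
  · intro h
    have h0 := congr_fun h 0
    have h1 := congr_fun h 1
    simp only [Fin.isValue, col_apply, SL_reduction_mod_hom_val, Pi.single_eq_same, ne_eq,
      one_ne_zero, not_false_eq_true, Pi.single_eq_of_ne] at h0 h1
    refine ⟨h0, ?_, h1⟩
    have hdet := (SLMOD(N) γ).det_coe
    rw [Matrix.det_fin_two] at hdet
    simpa [h0, h1] using hdet

/-- **`[SL₂(ℤ) : Γ₁(N)] = #{(a, c) ∈ (ℤ/Nℤ)² unimodular}`** for `N ≥ 1`: orbit–stabiliser for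
`SL₂(ℤ)` acting on `(ℤ/Nℤ)²` through the surjection `SL₂(ℤ) → SL₂(ℤ/Nℤ)` (Shimura §1.6;
Diamond–Shurman §1.2). [folklore] -/
theorem index_gamma1_eq_card [NeZero N] :
    (Gamma1 N).index = Nat.card {v : Fin 2 → ZMod N // IsCoprime (v 0) (v 1)} := by
  rw [gamma1_eq_comap_stabilizer,
    Subgroup.index_comap_of_surjective _ (specialLinearGroup_map_surjective N),
    MulAction.index_stabilizer, orbit_specialLinearGroup_single, ← Nat.card_coe_set_eq]
  rfl

end Gamma1

/-! ### Counting unimodular pairs modulo `N` -/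

section Count

/-- Coprimality in a product of rings is componentwise. [folklore] -/
theorem isCoprime_prod_iff {R S : Type*} [CommSemiring R] [CommSemiring S] {x y : R × S} :
    IsCoprime x y ↔ IsCoprime x.1 y.1 ∧ IsCoprime x.2 y.2 := by
  constructor
  · rintro ⟨a, b, h⟩
    exact ⟨⟨a.1, b.1, by simpa using congrArg Prod.fst h⟩,
      ⟨a.2, b.2, by simpa using congrArg Prod.snd h⟩⟩
  · rintro ⟨⟨a, b, h⟩, ⟨a', b', h'⟩⟩
    exact ⟨(a, a'), (b, b'), Prod.ext (by simpa using h) (by simpa using h')⟩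

/-- The number of unimodular pairs modulo `N` is multiplicative in `N` (Chinese remainder
theorem). [folklore] -/
theorem card_unimodular_mul {m n : ℕ} (h : m.Coprime n) :
    Nat.card {v : Fin 2 → ZMod (m * n) // IsCoprime (v 0) (v 1)} =
      Nat.card {v : Fin 2 → ZMod m // IsCoprime (v 0) (v 1)} *
        Nat.card {v : Fin 2 → ZMod n // IsCoprime (v 0) (v 1)} := by
  rw [← Nat.card_prod]
  refine Nat.card_congr ?_
  let e := ZMod.chineseRemainder h
  have he : ∀ {a c : ZMod (m * n)}, IsCoprime a c →
      IsCoprime (e a).1 (e c).1 ∧ IsCoprime (e a).2 (e c).2 :=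
    fun {a c} hac ↦ isCoprime_prod_iff.mp (show IsCoprime (e a) (e c) from hac.map e.toRingHom)
  have he' : ∀ {a c : ZMod m × ZMod n}, IsCoprime a.1 c.1 → IsCoprime a.2 c.2 →
      IsCoprime (e.symm a) (e.symm c) :=
    fun {a c} h₁ h₂ ↦
      show IsCoprime (e.symm a) (e.symm c) from (isCoprime_prod_iff.mpr ⟨h₁, h₂⟩).map e.symm.toRingHom
  exact
    { toFun := fun v ↦ (⟨fun i ↦ (e (v.1 i)).1, (he v.2).1⟩, ⟨fun i ↦ (e (v.1 i)).2, (he v.2).2⟩)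
      invFun := fun w ↦ ⟨fun i ↦ e.symm (w.1.1 i, w.2.1 i), he' w.1.2 w.2.2⟩
      left_inv := fun v ↦ Subtype.ext <| funext fun i ↦ by simp
      right_inv := fun w ↦ Prod.ext (Subtype.ext <| funext fun i ↦ by simp)
        (Subtype.ext <| funext fun i ↦ by simp) }

/-- Modulo a prime power `p^k`, `k ≥ 1`, a pair is unimodular iff one entry is a unit
(`ℤ/p^kℤ` is local with maximal ideal `(p)`). [folklore] -/
theorem isCoprime_iff_isUnit_or {p k : ℕ} (hp : p.Prime) (hk : 0 < k) {a c : ZMod (p ^ k)} :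
    IsCoprime a c ↔ IsUnit a ∨ IsUnit c := by
  haveI : NeZero (p ^ k) := ⟨pow_ne_zero _ hp.ne_zero⟩
  have key : ∀ x : ZMod (p ^ k), ¬IsUnit x → p ∣ x.val := by
    intro x hx
    rwa [← ZMod.natCast_zmod_val x, ZMod.isUnit_iff_coprime, Nat.coprime_pow_right_iff hk,
      Nat.coprime_comm, hp.coprime_iff_not_dvd, not_not] at hx
  constructor
  · rintro ⟨u, w, h⟩
    by_contra hac
    rw [not_or] at hac
    haveI : Fact p.Prime := ⟨hp⟩
    have hpk : p ∣ p ^ k := dvd_pow_self p hk.ne'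
    apply_fun ZMod.castHom hpk (ZMod p) at h
    rw [map_add, map_mul, map_mul, map_one, ← ZMod.natCast_zmod_val a,
      ← ZMod.natCast_zmod_val c, map_natCast, map_natCast,
      (ZMod.natCast_eq_zero_iff _ p).mpr (key a hac.1),
      (ZMod.natCast_eq_zero_iff _ p).mpr (key c hac.2)] at h
    simp at h
  · rintro (⟨u, rfl⟩ | ⟨u, rfl⟩)
    · exact ⟨↑u⁻¹, 0, by simp⟩
    · exact ⟨0, ↑u⁻¹, by simp⟩

/-- `#{units of ℤ/qℤ} = φ(q)` in `Nat.card` form. [folklore] -/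
theorem card_isUnit_zmod (q : ℕ) [NeZero q] : Nat.card {a : ZMod q // IsUnit a} = q.totient := by
  rw [← ZMod.card_units_eq_totient q, ← Nat.card_eq_fintype_card]
  refine Nat.card_congr
    { toFun := fun a ↦ a.2.unit
      invFun := fun u ↦ ⟨u, u.isUnit⟩
      left_inv := fun a ↦ Subtype.ext (by simp)
      right_inv := fun u ↦ Units.ext (by simp) }

/-- **Unimodular pairs modulo a prime power**: `#{(a, c) ∈ (ℤ/p^kℤ)² unimodular} =
p^{2k} − p^{2(k−1)} = p^{k−1}(p + 1) · p^{k−1}(p − 1)` for `k ≥ 1` (all pairs minus pairs of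
non-units). [folklore] -/
theorem card_unimodular_prime_pow {p k : ℕ} (hp : p.Prime) (hk : 0 < k) :
    Nat.card {v : Fin 2 → ZMod (p ^ k) // IsCoprime (v 0) (v 1)} =
      p ^ (k - 1) * (p + 1) * (p ^ (k - 1) * (p - 1)) := by
  classical
  haveI : NeZero (p ^ k) := ⟨pow_ne_zero _ hp.ne_zero⟩
  obtain ⟨j, rfl⟩ := Nat.exists_eq_add_one_of_ne_zero hk.ne'
  simp only [Nat.add_sub_cancel]
  have hp1 := hp.one_le
  set q := p ^ (j + 1) with hq
  -- units and non-units of `ℤ/qℤ`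
  have hu : Nat.card {a : ZMod q // IsUnit a} = p ^ j * (p - 1) := by
    rw [card_isUnit_zmod, hq, Nat.totient_prime_pow hp hk, Nat.add_sub_cancel]
  have hnu : Nat.card {a : ZMod q // ¬IsUnit a} = p ^ j := by
    have hsum := Nat.card_congr (Equiv.sumCompl fun a : ZMod q ↦ IsUnit a)
    rw [Nat.card_sum, Nat.card_zmod, hu] at hsum
    have hpj : p ^ j * (p - 1) + p ^ j = q := by
      rw [hq, pow_succ, ← mul_add_one, Nat.sub_add_cancel hp1]
    omega
  -- unimodular pairs and pairs of non-units
  have hS : Nat.card {v : Fin 2 → ZMod q // IsCoprime (v 0) (v 1)} +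
      Nat.card {v : Fin 2 → ZMod q // ¬IsCoprime (v 0) (v 1)} = q ^ 2 := by
    have hsum := Nat.card_congr (Equiv.sumCompl fun v : Fin 2 → ZMod q ↦ IsCoprime (v 0) (v 1))
    rwa [Nat.card_sum, Nat.card_fun, Nat.card_zmod, Nat.card_eq_fintype_card (α := Fin 2),
      Fintype.card_fin] at hsum
  have hT : Nat.card {v : Fin 2 → ZMod q // ¬IsCoprime (v 0) (v 1)} = (p ^ j) ^ 2 := by
    rw [sq, ← hnu, ← Nat.card_prod]
    refine Nat.card_congr
      { toFun := fun v ↦ (⟨v.1 0, fun h0 ↦ v.2 ((isCoprime_iff_isUnit_or hp hk).mpr (Or.inl h0))⟩,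
          ⟨v.1 1, fun h1 ↦ v.2 ((isCoprime_iff_isUnit_or hp hk).mpr (Or.inr h1))⟩)
        invFun := fun w ↦ ⟨![w.1.1, w.2.1], fun h' ↦
          ((isCoprime_iff_isUnit_or hp hk).mp h').elim w.1.2 w.2.2⟩
        left_inv := fun v ↦ Subtype.ext <| funext fun i ↦ by fin_cases i <;> rfl
        right_inv := fun w ↦ rfl }
  rw [hT, hq] at hS
  zify [hp1] at hS ⊢
  linear_combination hS

/-- **Unimodular pairs modulo `N`**: `#{(a, c) ∈ (ℤ/Nℤ)² unimodular} = ∏_{p^k ∥ N}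
p^{k−1}(p + 1) · p^{k−1}(p − 1) = N² ∏_{p ∣ N} (1 − p^{−2})` for `N ≥ 1` (multiplicativity and the
prime-power count). [folklore] -/
theorem card_unimodular (N : ℕ) [NeZero N] :
    Nat.card {v : Fin 2 → ZMod N // IsCoprime (v 0) (v 1)} =
      N.factorization.prod fun p k ↦ p ^ (k - 1) * (p + 1) * (p ^ (k - 1) * (p - 1)) := by
  have hmult := Nat.multiplicative_factorization
    (fun n ↦ Nat.card {v : Fin 2 → ZMod n // IsCoprime (v 0) (v 1)})
    (fun m n hmn ↦ card_unimodular_mul hmn) (by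
      rw [Nat.card_congr (Equiv.subtypeUnivEquiv fun v ↦ ⟨0, 0, Subsingleton.elim _ _⟩),
        Nat.card_unique])
    (NeZero.ne N)
  rw [hmult]
  refine Finsupp.prod_congr fun p hp ↦ ?_
  exact card_unimodular_prime_pow (Nat.prime_of_mem_primeFactors hp)
    (Nat.pos_of_ne_zero (Finsupp.mem_support_iff.mp hp))

end Count

/-! ### `[Γ₀(N) : Γ₁(N)] = φ(N)` and the index of `Γ₀(N)` -/

section Gamma0

variable (N : ℕ) [NeZero N]

/-- **`[Γ₀(N) : Γ₁(N)] = φ(N)`**: `Γ₁(N)` is the kernel of the surjection `Γ₀(N) → (ℤ/Nℤ)ˣ`,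
`γ ↦ d mod N` (Mathlib `Gamma0Map`; Diamond–Shurman Ex. 1.2.3(d)).
[cite: DiamondShurman2005, Ex. 1.2.3(d)] -/
theorem relIndex_gamma1_gamma0 : (Gamma1 N).relIndex (Gamma0 N) = N.totient := by
  let f : Gamma0 N →* (ZMod N)ˣ := (Gamma0Map N).toHomUnits
  have hker : (Gamma1 N).subgroupOf (Gamma0 N) = f.ker := by
    ext A
    rw [Subgroup.mem_subgroupOf, MonoidHom.mem_ker, ← Units.val_eq_one,
      MonoidHom.coe_toHomUnits]
    change _ ↔ Gamma0Map N A = 1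
    rw [← Gamma1_mem', Gamma1_to_Gamma0_mem, Gamma1_mem]
  have hsurj : Function.Surjective f := by
    intro u
    set d : ℕ := (u : ZMod N).val with hd
    set a : ℕ := ((u⁻¹ : (ZMod N)ˣ) : ZMod N).val with ha
    have had : (((a : ℤ) * d - 1 : ℤ) : ZMod N) = 0 := by
      push_cast
      rw [ha, hd, ZMod.natCast_zmod_val, ZMod.natCast_zmod_val, Units.inv_mul, sub_self]
    obtain ⟨b, hb⟩ := (ZMod.intCast_zmod_eq_zero_iff_dvd _ N).mp had
    refine ⟨⟨⟨!![(a : ℤ), b; (N : ℤ), (d : ℤ)], ?_⟩, ?_⟩, ?_⟩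
    · rw [Matrix.det_fin_two_of]
      linear_combination hb
    · simp [Gamma0_mem]
    · ext
      rw [MonoidHom.coe_toHomUnits]
      change (((d : ℤ) : ZMod N)) = u
      rw [Int.cast_natCast, hd, ZMod.natCast_zmod_val]
  rw [Subgroup.relIndex, hker, Subgroup.index_ker, MonoidHom.range_eq_top.mpr hsurj,
    Subgroup.card_top, Nat.card_eq_fintype_card, ZMod.card_units_eq_totient]

/-- **`[SL₂(ℤ) : Γ₀(N)] · φ(N) = ∏_{p^k ∥ N} p^{k−1}(p + 1) · p^{k−1}(p − 1)`**, from
`[SL₂(ℤ) : Γ₁(N)] = [SL₂(ℤ) : Γ₀(N)] [Γ₀(N) : Γ₁(N)]`. [folklore] -/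
theorem index_gamma0_mul_totient :
    (Gamma0 N).index * N.totient =
      N.factorization.prod fun p k ↦ p ^ (k - 1) * (p + 1) * (p ^ (k - 1) * (p - 1)) := by
  rw [← card_unimodular N, ← index_gamma1_eq_card N, ← relIndex_gamma1_gamma0 N, mul_comm]
  exact Subgroup.relIndex_mul_index (Gamma1_in_Gamma0 N)

/-- **Index of `Γ₀(N)`** (discharge of the fact `index_gamma0_eq_gamma0Index` of
`ModularCurve.lean`): `[SL₂(ℤ) : Γ₀(N)] = ∏_{p^e ∥ N} p^{e−1}(p + 1) = N ∏_{p ∣ N} (1 + 1/p)` for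
`N ≥ 1` (Shimura Prop. 1.43, first assertion, p. 42; Diamond–Shurman Ex. 1.2.3(e)). Proof:
cancel `φ(N) > 0` in `index_gamma0_mul_totient` against Euler's product
`φ(N) = ∏ p^{e−1}(p − 1)`. The fact is `ℕ → Prop` (its `[NeZero N]` section variable is not part
of the statement) and is false at `N = 0` (`Γ₀(0)` has infinite index, `gamma0Index 0 = 1`), so
the discharge assumes `[NeZero N]`, as the source does. [cite: ShimuraIATAF1971, Prop. 1.43] -/
theorem index_gamma0_eq_gamma0Index_holds : index_gamma0_eq_gamma0Index N := by
  unfold index_gamma0_eq_gamma0Index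
  have hφ : 0 < N.totient := Nat.totient_pos.mpr (NeZero.pos N)
  refine Nat.eq_of_mul_eq_mul_right hφ ?_
  rw [index_gamma0_mul_totient, gamma0Index, Nat.totient_eq_prod_factorization (NeZero.ne N),
    ← Finsupp.prod_mul]

end Gamma0

end Literature.NumberTheory.EllipticCurves.ModularForms

end
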